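import Literature.NumberTheory.Sieve.VinogradovExpSumTools
import HarnessLib

/-!
# Harper's minor-arc estimate, II: splitting `∑ min(V, 1/(2‖a'(n₁−n₂)/r + ε‖))` by residues

Topic `Literature/NumberTheory/Sieve`; a PROVED tool file toward
`Literature.NumberTheory.DiophantineGeometry.XYZUpperHalf` ([Harper2016, Cor. 1]). This is the
case analysis "Now if `p ∤ q` then … and therefore …; similarly, if `p ∣ q` …" in the proof of
Theorem 1 of op. cit. (§3, p. 12), in the unified form `p(n₁−n₂)θ = a'(n₁−n₂)/r + ε` with
`(a', r) = 1` (`r = q` or `q/p`) and `|ε| ≤ 1/(2r)`: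

* `geomBound_le_inv_distInt` — if `|ε| ≤ ‖s‖/2` then `min(V, 1/(2‖s + ε‖)) ≤ 1/‖s‖`.
* `sum_sum_geomBound_residue_split` — for a finite set `S ⊆ ℕ`, `0 ≤ V`, and `T` bounding the
  number of pairs `(n₁, n₂) ∈ S²` in each NONZERO class `n₁ − n₂ ≡ b (mod r)`:
  `∑_{n₁,n₂ ∈ S} min(V, 1/(2‖a'(n₁−n₂)/r + ε(n₁,n₂)‖))
     ≤ 2 T r (1 + log r) + ∑_{n₁ ≡ n₂ (mod r)} min(V, 1/(2‖ε(n₁,n₂)‖))`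
  (off the zero class `‖·‖ ≥ ‖a'b/r‖/2` and the points `a'b/r`, `0 < b < r`, are `1/r`-spaced:
  `Vinogradov.sum_inv_distInt_le_of_separated`).

## References

* A. J. Harper, Compositio Math. 152 (2016) 1121–1158, §3, p. 12 [Harper2016].
* M. B. Nathanson, *Additive Number Theory: The Classical Bases*, GTM 164, §4.4 [Nathanson1996].
-/

noncomputable section

open Finset Real
open Literature.NumberTheory.Sieve.Vinogradov

namespace Literature.NumberTheory.Sieve

/-- If `|ε| ≤ ‖s‖/2` and `‖s‖ > 0` then `min(V, 1/(2‖s + ε‖)) ≤ 1/‖s‖`. [cite: Harper2016, §3, p. 12] -/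
theorem geomBound_le_inv_distInt {s ε : ℝ} (V : ℝ) (hs : 0 < distInt s) (hε : |ε| ≤ distInt s / 2) :
    geomBound V (s + ε) ≤ 1 / distInt s := by
  have h1 : distInt s / 2 ≤ distInt (s + ε) := by
    have h2 : distInt s - distInt (s + ε - s) ≤ distInt (s + ε) := distInt_sub_distInt_le (s + ε) s
    rw [show s + ε - s = ε by ring] at h2
    have h3 : distInt ε ≤ |ε| := by
      have := distInt_le_abs_sub_int ε 0; simpa using this
    linarith
  have hpos : 0 < distInt (s + ε) := lt_of_lt_of_le (by linarith) h1
  calc geomBound V (s + ε) ≤ 1 / (2 * distInt (s + ε)) := geomBound_le_inv V hpos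
    _ ≤ 1 / (2 * (distInt s / 2)) := by
        apply one_div_le_one_div_of_le (by linarith); linarith
    _ = 1 / distInt s := by ring

/-- **Splitting by residues** (Harper, §3, p. 12, unified over `p ∤ q` / `p ∣ q`). Let `r ≥ 1`,
`(a', r) = 1`, `S ⊆ ℕ` finite, `|ε(n₁, n₂)| ≤ 1/(2r)` on `S²`, `V ≥ 0`, and suppose every nonzero
class `{(n₁, n₂) ∈ S² : n₁ − n₂ ≡ b (mod r)}`, `0 < b < r`, has at most `T` elements. Then
`∑_{n₁,n₂ ∈ S} min(V, 1/(2‖a'(n₁−n₂)/r + ε‖)) ≤ 2 T r (1 + log r) + ∑_{r ∣ n₁−n₂} min(V, 1/(2‖ε‖))`.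
[cite: Harper2016, §3, p. 12] -/
theorem sum_sum_geomBound_residue_split (S : Finset ℕ) {r : ℕ} (hr : 0 < r) {a' : ℤ}
    (hcop : IsCoprime a' (r : ℤ)) (ε : ℕ → ℕ → ℝ)
    (hε : ∀ n₁ ∈ S, ∀ n₂ ∈ S, |ε n₁ n₂| ≤ 1 / (2 * (r : ℝ))) {V T : ℝ} (hV : 0 ≤ V) (hT0 : 0 ≤ T)
    (hT : ∀ b : ℕ, 0 < b → b < r →
      (((S ×ˢ S).filter (fun nn => ((nn.1 : ℤ) - nn.2) % r = b)).card : ℝ) ≤ T) :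
    ∑ n₁ ∈ S, ∑ n₂ ∈ S, geomBound V ((a' : ℝ) * ((n₁ : ℝ) - n₂) / r + ε n₁ n₂) ≤
      2 * T * r * (1 + Real.log r) +
        ∑ nn ∈ (S ×ˢ S).filter (fun nn => (r : ℤ) ∣ ((nn.1 : ℤ) - nn.2)),
          geomBound V (ε nn.1 nn.2) := by
  classical
  have hrr : (0 : ℝ) < r := by exact_mod_cast hr
  have hrz : (0 : ℤ) < r := by exact_mod_cast hr
  -- `r ∤ a' m` for `0 < |m| < r`… more precisely for `r ∤ m`
  have hndvd : ∀ m : ℤ, ¬ (r : ℤ) ∣ m → ¬ (r : ℤ) ∣ a' * m := by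
    intro m hm h
    exact hm (hcop.symm.dvd_of_dvd_mul_left h)
  -- `‖a' m/r‖ ≥ 1/r` when `r ∤ m` (cf. `MoebiusWalsh.one_div_le_distInt_int_div`)
  have hfar : ∀ m : ℤ, ¬ (r : ℤ) ∣ m → 1 / (r : ℝ) ≤ distInt ((a' : ℝ) * m / r) := by
    intro m hm
    have hm' := hndvd m hm
    unfold distInt
    set n := round ((a' : ℝ) * m / r) with hn
    have hne : a' * m - n * r ≠ 0 := fun h => hm' ⟨n, by linarith⟩
    have h1 : (1 : ℝ) ≤ |(((a' * m - n * r : ℤ)) : ℝ)| := by exact_mod_cast Int.one_le_abs hne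
    have heq : (a' : ℝ) * m / r - n = (((a' * m - n * r : ℤ)) : ℝ) / r := by push_cast; field_simp
    rw [heq, abs_div, abs_of_pos hrr]
    exact div_le_div_of_nonneg_right h1 hrr.le
  set G : ℕ × ℕ → ℝ := fun nn => geomBound V ((a' : ℝ) * ((nn.1 : ℝ) - nn.2) / r + ε nn.1 nn.2) with hG
  have hG0 : ∀ nn, 0 ≤ G nn := fun nn => geomBound_nonneg hV _
  rw [← Finset.sum_product (s := S) (t := S) (f := G)]
  set Z := (S ×ˢ S).filter (fun nn => (r : ℤ) ∣ ((nn.1 : ℤ) - nn.2)) with hZ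
  set NZ := (S ×ˢ S).filter (fun nn => ¬ (r : ℤ) ∣ ((nn.1 : ℤ) - nn.2)) with hNZ
  rw [← Finset.sum_filter_add_sum_filter_not (S ×ˢ S) (fun nn => (r : ℤ) ∣ ((nn.1 : ℤ) - nn.2)),
    ← hZ, ← hNZ, add_comm]
  refine add_le_add ?_ ?_
  · ------------------------------------------------------------------
    -- the nonzero classes
    set g : ℕ × ℕ → ℕ := fun nn => (((nn.1 : ℤ) - nn.2) % r).toNat with hg
    have hgval : ∀ nn : ℕ × ℕ, ((g nn : ℕ) : ℤ) = ((nn.1 : ℤ) - nn.2) % r := by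
      intro nn; rw [hg]; exact Int.toNat_of_nonneg (Int.emod_nonneg _ hrz.ne')
    set Rset := (Finset.range r).filter (fun b => b ≠ 0) with hRset
    have hmaps : ∀ nn ∈ NZ, g nn ∈ Rset := by
      intro nn hnn
      rw [hNZ, Finset.mem_filter] at hnn
      rw [hRset, Finset.mem_filter, Finset.mem_range]
      constructor
      · have : ((g nn : ℕ) : ℤ) < r := by rw [hgval]; exact Int.emod_lt_of_pos _ hrz
        exact_mod_cast this
      · intro h0
        apply hnn.2
        have : ((nn.1 : ℤ) - nn.2) % r = 0 := by rw [← hgval, h0]; rfl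
        exact Int.dvd_of_emod_eq_zero this
    rw [← Finset.sum_fiberwise_of_maps_to hmaps]
    -- each fibre: `≤ T · (1/‖a' b/r‖)`
    have hfib : ∀ b ∈ Rset, ∑ nn ∈ NZ.filter (fun nn => g nn = b), G nn ≤
        T * (1 / distInt ((a' : ℝ) * b / r)) := by
      intro b hb
      rw [hRset, Finset.mem_filter, Finset.mem_range] at hb
      obtain ⟨hbr, hb0⟩ := hb
      have hbnd : ¬ (r : ℤ) ∣ (b : ℤ) := by
        intro h
        have := Int.le_of_dvd (by exact_mod_cast Nat.pos_of_ne_zero hb0) h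
        have : (r : ℤ) ≤ b := this
        exact absurd (by exact_mod_cast this : r ≤ b) (by omega)
      have hsb : 1 / (r : ℝ) ≤ distInt ((a' : ℝ) * b / r) := by
        have := hfar b hbnd; push_cast at this; exact this
      have hds : 0 < distInt ((a' : ℝ) * b / r) := lt_of_lt_of_le (by positivity) hsb
      -- pointwise
      have hpt : ∀ nn ∈ NZ.filter (fun nn => g nn = b), G nn ≤ 1 / distInt ((a' : ℝ) * b / r) := by
        intro nn hnn
        rw [Finset.mem_filter] at hnn
        obtain ⟨hnnNZ, hgb⟩ := hnn
        have hnnS : nn ∈ S ×ˢ S := (Finset.mem_filter.mp hnnNZ).1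
        rw [Finset.mem_product] at hnnS
        -- `n₁ - n₂ = b + r k`
        have hmod : ((nn.1 : ℤ) - nn.2) % r = b := by rw [← hgval, hgb]
        obtain ⟨k, hk⟩ : ∃ k : ℤ, (nn.1 : ℤ) - nn.2 = b + r * k := by
          refine ⟨((nn.1 : ℤ) - nn.2) / r, ?_⟩
          have := Int.emod_add_ediv_mul ((nn.1 : ℤ) - nn.2) r
          rw [hmod] at this; linarith
        have hsplit : (a' : ℝ) * ((nn.1 : ℝ) - nn.2) / r + ε nn.1 nn.2 =
            ((a' : ℝ) * b / r + ε nn.1 nn.2) + ((a' * k : ℤ) : ℝ) := by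
          have hk' : ((nn.1 : ℝ) - nn.2) = (b : ℝ) + r * k := by exact_mod_cast hk
          rw [hk']; push_cast; field_simp; ring
        simp only [hG]
        rw [hsplit, show geomBound V ((a' : ℝ) * b / r + ε nn.1 nn.2 + ((a' * k : ℤ) : ℝ)) =
          geomBound V ((a' : ℝ) * b / r + ε nn.1 nn.2) by unfold geomBound; rw [distInt_add_int]]
        apply geomBound_le_inv_distInt V hds
        calc |ε nn.1 nn.2| ≤ 1 / (2 * (r : ℝ)) := hε nn.1 hnnS.1 nn.2 hnnS.2
          _ = (1 / (r : ℝ)) / 2 := by ring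
          _ ≤ distInt ((a' : ℝ) * b / r) / 2 := by linarith
      have hsub : NZ.filter (fun nn => g nn = b) ⊆
          (S ×ˢ S).filter (fun nn => ((nn.1 : ℤ) - nn.2) % r = b) := by
        intro nn hnn
        rw [Finset.mem_filter] at hnn ⊢
        exact ⟨(Finset.mem_filter.mp hnn.1).1, by rw [← hgval, hnn.2]⟩
      have hcard : ((NZ.filter (fun nn => g nn = b)).card : ℝ) ≤ T :=
        le_trans (by exact_mod_cast Finset.card_le_card hsub) (hT b (Nat.pos_of_ne_zero hb0) hbr)
      calc ∑ nn ∈ NZ.filter (fun nn => g nn = b), G nn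
          ≤ ∑ nn ∈ NZ.filter (fun nn => g nn = b), (1 / distInt ((a' : ℝ) * b / r)) :=
            Finset.sum_le_sum hpt
        _ = (NZ.filter (fun nn => g nn = b)).card * (1 / distInt ((a' : ℝ) * b / r)) := by
            rw [Finset.sum_const, nsmul_eq_mul]
        _ ≤ T * (1 / distInt ((a' : ℝ) * b / r)) :=
            mul_le_mul_of_nonneg_right hcard (by positivity)
    -- the spacing sum
    have hsp : ∑ b ∈ Rset, 1 / (2 * distInt ((a' : ℝ) * b / r)) ≤ (1 / (1 / (r : ℝ))) * (1 + Real.log r) := by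
      apply sum_inv_distInt_le_of_separated Rset (fun b : ℕ => (a' : ℝ) * b / r) (δ := 1 / r)
        (by positivity) (m := r)
      · rw [show (1 : ℝ) / (2 * (1 / r)) = r / 2 by field_simp]; linarith
      · intro i hi j hj hij
        rw [hRset, Finset.mem_filter, Finset.mem_range] at hi hj
        have hnd : ¬ (r : ℤ) ∣ ((i : ℤ) - j) := by
          intro h
          have hlt : |(i : ℤ) - j| < r := by rw [abs_lt]; constructor <;> omega
          have := Int.eq_zero_of_abs_lt_dvd h hlt
          omega
        have := hfar ((i : ℤ) - j) hnd
        push_cast at this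
        rw [show (a' : ℝ) * i / r - (a' : ℝ) * j / r = (a' : ℝ) * ((i : ℝ) - j) / r by ring]
        exact this
      · intro i hi
        rw [hRset, Finset.mem_filter, Finset.mem_range] at hi
        have hnd : ¬ (r : ℤ) ∣ (i : ℤ) := by
          intro h
          have := Int.le_of_dvd (by exact_mod_cast Nat.pos_of_ne_zero hi.2) h
          have : (r : ℤ) ≤ i := this
          exact absurd (by exact_mod_cast this : r ≤ i) (by omega)
        have := hfar i hnd; push_cast at this; exact this
    rw [one_div_one_div] at hsp
    calc ∑ b ∈ Rset, ∑ nn ∈ NZ.filter (fun nn => g nn = b), G nn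
        ≤ ∑ b ∈ Rset, T * (1 / distInt ((a' : ℝ) * b / r)) := Finset.sum_le_sum hfib
      _ = 2 * T * ∑ b ∈ Rset, 1 / (2 * distInt ((a' : ℝ) * b / r)) := by
          rw [Finset.mul_sum]
          refine Finset.sum_congr rfl fun b _ => ?_
          have : (2 : ℝ) ≠ 0 := by norm_num
          field_simp
      _ ≤ 2 * T * ((r : ℝ) * (1 + Real.log r)) := mul_le_mul_of_nonneg_left hsp (by positivity)
      _ = 2 * T * r * (1 + Real.log r) := by ring
  · ------------------------------------------------------------------
    -- the zero class: `a'(n₁ - n₂)/r ∈ ℤ`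
    refine le_of_eq (Finset.sum_congr rfl fun nn hnn => ?_)
    rw [hZ, Finset.mem_filter] at hnn
    obtain ⟨k, hk⟩ := hnn.2
    simp only [hG]
    have hsplit : (a' : ℝ) * ((nn.1 : ℝ) - nn.2) / r + ε nn.1 nn.2 = ε nn.1 nn.2 + ((a' * k : ℤ) : ℝ) := by
      have hk' : ((nn.1 : ℝ) - nn.2) = (r : ℝ) * k := by exact_mod_cast hk
      rw [hk']; push_cast; field_simp; ring
    rw [hsplit]
    unfold geomBound; rw [distInt_add_int]

end Literature.NumberTheory.Sieve

end
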